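import Summits.QuantumFields.YangMills.Theorems.AllWindowsColdBoxBoxHighLineGhostPairing

/-!
# T-S5.7d input: the Hilbert–Schmidt size of the ghost quadratic form, `Σ_{ij} (M_H)_{ij}² ≤ C·H⁴`
# (STUB-PLAN-S5-STEP2 §8 «`Σ M_H² ≤ C H⁴ log^m` from ✓T-S5.9 `ghostKernelDecay` + ✓8a shell sums»; planner ym-idea-2 g18 routing 2026-08-29T19:46:09Z (iii);
# LINE-19 S5 ⟨stmt-QuantumFields-24004⟩/⟨24335⟩)

Width seat `ym-line-sfw-p2-w3` (g40).  `M_{ij} = −½ tr(X_i X_j) − ½[i=j] tr Y_{i.1}` (✓`GhostFP.ghostM`); by the pairing decay ✓`abs_trace_ghostX_edgeMat_mul_le`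
`|tr(X_iX_j)| ≤ K Σ_{z,w} endInd_i(z) endInd_j(w) (1+d(z,w))⁻⁴`, Cauchy–Schwarz over the (at most four) endpoint pairs, `Σ_j endInd_j(w) = 24` (eight edges
and three colours at an interior site, ✓`sum_ite_base_eq`/✓`sum_ite_tip_eq`), the shell sum `Σ_w (1+d(z,w))⁻⁶ ≤ 2048` (LEAD's ✓`sum_plaquettes_inv_pow_six_le`,
sites embedded as plaquettes) and `|tr Y_e| ≤ 288 C_G` give

  ★ `GhostFP.sum_sq_ghostM_le`: `Σ_i Σ_j (ghostM H i j)² ≤ ghostMConst C_G · H⁴` for `H ≥ 1` (no logarithm), with `#(LandauFree H × Fin 3) ≤ 972 H⁴`.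

Everything proved; no definitions besides the explicit constant `ghostMConst`; standard axioms.  HONEST LABEL: an input of ONE brick (7d) of STEP 2 of the
XL stub S5 of a critic-PASSed DRAFT line; 7d, S5, U5, ⟨24004⟩ ⟨24335⟩ ⟨24336⟩ remain OPEN; no crux, rung or summit is proved; **the Yang–Mills mass gap is NOT
proved by this file.**
-/

set_option autoImplicit false

noncomputable section

open Matrix Finset
open scoped Matrix.Norms.Operator
open Literature.MathematicalPhysics.QuantumFieldTheory.Balaban1983to89.B10Eq18SigmaSU2 (su2Coord)
open Literature.MathematicalPhysics.QuantumFieldTheory.AxialGauge (boxEdges card_boxEdges)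
open Literature.MathematicalPhysics.QuantumLattice (LGConfig ZdEdge ZdPlaquette)
open Literature.Probability.LatticeModels (Site dirichletMatrix)

namespace Summit.QuantumFields.YangMills.Theorems.AllWindowsColdBoxBoxHighLine

namespace GhostFP

open EdgeChartGaussian (siteDist_comm sum_plaquettes_inv_pow_six_le)

variable {H : ℕ}

/-! ## Counting lemmas -/

/-- `‖X(e_c)‖ ≤ 3`. -/
theorem norm_su2Coord_single_le (c : Fin 3) : ‖su2Coord (Pi.single c (1 : ℝ))‖ ≤ 3 := by
  have h := Parity.norm_su2Coord_le (WithLp.toLp 2 (Pi.single c (1 : ℝ)) : E3)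
  rw [WithLp.ofLp_toLp] at h
  refine h.trans ?_
  have : ‖(WithLp.toLp 2 (Pi.single c (1 : ℝ)) : E3)‖ = 1 := by
    rw [EuclideanSpace.norm_eq]
    simp [Pi.single_apply, Finset.sum_ite_eq', Real.sqrt_one]
  rw [this]; norm_num

/-- At an interior site `w`, the endpoint weights of all free edges sum to `8` (four edges in, four edges out). -/
theorem sum_endInd_free (w : ↥(interiorSites H)) : ∑ f : LandauFree H, endInd f.1.1 (w : Site 4) = 8 := by
  unfold endInd
  rw [Finset.sum_add_distrib]
  have h1 : ∑ f : LandauFree H, (if (w : Site 4) = f.1.1.1 then (1 : ℝ) else 0) = 4 := by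
    have h := sum_ite_base_eq w.2 (fun _ => (1 : ℝ))
    simp only [Finset.sum_const, Finset.card_univ, Fintype.card_fin] at h
    rw [show (∑ f : LandauFree H, if (w : Site 4) = f.1.1.1 then (1 : ℝ) else 0) =
      ∑ f : LandauFree H, if f.1.1.1 = (w : Site 4) then (1 : ℝ) else 0 from Finset.sum_congr rfl fun f _ => by simp only [eq_comm], h]
    norm_num
  have h2 : ∑ f : LandauFree H, (if (w : Site 4) = f.1.1.1 + Pi.single f.1.1.2 1 then (1 : ℝ) else 0) = 4 := by
    have h := sum_ite_tip_eq w.2 (fun _ => (1 : ℝ))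
    simp only [Finset.sum_const, Finset.card_univ, Fintype.card_fin] at h
    rw [show (∑ f : LandauFree H, if (w : Site 4) = f.1.1.1 + Pi.single f.1.1.2 1 then (1 : ℝ) else 0) =
      ∑ f : LandauFree H, if f.1.1.1 + Pi.single f.1.1.2 1 = (w : Site 4) then (1 : ℝ) else 0 from
        Finset.sum_congr rfl fun f _ => by simp only [eq_comm], h]
    norm_num
  rw [h1, h2]; norm_num

/-- … hence over the chart coordinates (edge, colour): `Σ_j endInd_j(w) = 24`. -/
theorem sum_endInd_coord (w : ↥(interiorSites H)) : ∑ j : LandauFree H × Fin 3, endInd j.1.1.1 (w : Site 4) = 24 := by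
  rw [Fintype.sum_prod_type]
  simp only [Finset.sum_const, Finset.card_univ, Fintype.card_fin, nsmul_eq_mul]
  push_cast
  rw [← Finset.mul_sum, sum_endInd_free]; norm_num

/-- The shell sum over the interior sites: `Σ_w (1 + d(z,w))⁻⁶ ≤ 2048` (sites embedded as plaquettes into LEAD's ✓`sum_plaquettes_inv_pow_six_le`). -/
theorem sum_interior_inv_pow_six_le (z : Site 4) : ∑ w : ↥(interiorSites H), 1 / (1 + siteDist z (w : Site 4)) ^ 6 ≤ 2048 := by
  let emb : Site 4 ↪ ZdPlaquette 4 := ⟨fun y => (y, ⟨((0 : Fin 4), (1 : Fin 4)), by decide⟩), fun a b h => congrArg Prod.fst h⟩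
  have h := sum_plaquettes_inv_pow_six_le ((interiorSites H).map emb) z
  rw [Finset.sum_map] at h
  have h' : ∑ w ∈ interiorSites H, 1 / (1 + siteDist z w) ^ 6 ≤ 2048 := by
    refine le_trans (le_of_eq (Finset.sum_congr rfl fun w _ => ?_)) h
    show 1 / (1 + siteDist z w) ^ 6 = 1 / (1 + siteDist (emb w).1 z) ^ 6
    rw [siteDist_comm]; rfl
  rwa [← Finset.sum_coe_sort] at h'

/-- Weighted Cauchy–Schwarz for a double sum: `(Σ_{z,w} G·c)² ≤ (Σ c)(Σ G²·c)` for `c ≥ 0`. -/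
theorem sq_double_sum_le {κ : Type*} [Fintype κ] (c G : κ → κ → ℝ) (hc : ∀ z w, 0 ≤ c z w) :
    (∑ z, ∑ w, G z w * c z w) ^ 2 ≤ (∑ z, ∑ w, c z w) * ∑ z, ∑ w, G z w ^ 2 * c z w := by
  have h := sq_sum_mul_le (fun zw : κ × κ => c zw.1 zw.2) (fun zw => G zw.1 zw.2) (fun zw => hc zw.1 zw.2)
  simp only [Fintype.sum_prod_type] at h
  exact h

/-- The number of chart coordinates: `#(LandauFree H × Fin 3) ≤ 972 H⁴` for `H ≥ 1`. -/
theorem card_coord_le (hH : 1 ≤ H) : (Fintype.card (LandauFree H × Fin 3) : ℝ) ≤ 972 * (H : ℝ) ^ 4 := by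
  have hc : Fintype.card (LandauFree H) = (boxEdges 4 (2 * H + 1)).card := by
    rw [Fintype.card_congr (EdgeChart.freeEquiv H).symm, Fintype.card_coe]
  rw [Fintype.card_prod, Fintype.card_fin, hc, card_boxEdges]
  have hH' : (1 : ℝ) ≤ H := by exact_mod_cast hH
  rw [show 2 * H + 1 - 1 = 2 * H by omega]
  push_cast
  have h3 : (2 * (H : ℝ) + 1) ^ 3 ≤ (3 * H) ^ 3 := pow_le_pow_left₀ (by positivity) (by linarith) 3
  have hH0 : (0 : ℝ) ≤ H := by positivity
  nlinarith [h3, mul_le_mul_of_nonneg_left h3 hH0, pow_nonneg hH0 4, hH']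

/-! ## The off-diagonal part -/

/-- The explicit constant of the bound (depends only on the Coulomb constant `C_G` of ✓`ghostKernelDecay`). -/
def ghostMConst (CG : ℝ) : ℝ := 972 * (196608 * (2985984 * CG ^ 2) ^ 2 + 41472 * CG ^ 2)

/-- **`(tr X_iX_j)² ≤ 4K² · Σ_{z,w} endInd_i(z) endInd_j(w) (1+d(z,w))⁻⁸`**, `K = 2985984·C_G²`. -/
theorem trace_sq_le (hG0 : ∀ x z : ↥(interiorSites H), 0 ≤ (dirichletMatrix (interiorSites H))⁻¹ x z) {CG : ℝ} (hCG : 0 ≤ CG)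
    (hGd : ∀ x z : ↥(interiorSites H), (dirichletMatrix (interiorSites H))⁻¹ x z ≤ CG / (1 + siteDist (x : Site 4) (z : Site 4)) ^ 2)
    (i j : LandauFree H × Fin 3) :
    (ghostX H (basisLinkL H i) * ghostX H (basisLinkL H j)).trace ^ 2 ≤
      4 * (2985984 * CG ^ 2) ^ 2 * ∑ z : ↥(interiorSites H), ∑ w : ↥(interiorSites H),
        (1 / (1 + siteDist (z : Site 4) (w : Site 4)) ^ 4) ^ 2 * (endInd i.1.1.1 (z : Site 4) * endInd j.1.1.1 (w : Site 4)) := by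
  set K : ℝ := 2985984 * CG ^ 2 with hK
  set S := ∑ z : ↥(interiorSites H), ∑ w : ↥(interiorSites H),
    endInd i.1.1.1 (z : Site 4) * endInd j.1.1.1 (w : Site 4) / (1 + siteDist (z : Site 4) (w : Site 4)) ^ 4 with hS
  have hS0 : 0 ≤ S := Finset.sum_nonneg fun z _ => Finset.sum_nonneg fun w _ => by
    have := endInd_nonneg i.1.1.1 (z : Site 4); have := endInd_nonneg j.1.1.1 (w : Site 4)
    have := GhostKernel.siteDist_nonneg (z : Site 4) (w : Site 4); positivity
  have hT : |(ghostX H (basisLinkL H i) * ghostX H (basisLinkL H j)).trace| ≤ K * S := by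
    have h := abs_trace_ghostX_edgeMat_mul_le hG0 hCG hGd i.1.1.1 j.1.1.1 (su2Coord (Pi.single i.2 (1 : ℝ)))
      (su2Coord (Pi.single j.2 (1 : ℝ)))
    refine h.trans ?_
    rw [hK]
    have h1 := norm_su2Coord_single_le i.2
    have h2 := norm_su2Coord_single_le j.2
    have hn1 := norm_nonneg (su2Coord (Pi.single i.2 (1 : ℝ)))
    have hn2 := norm_nonneg (su2Coord (Pi.single j.2 (1 : ℝ)))
    have : ‖su2Coord (Pi.single i.2 (1 : ℝ))‖ * ‖su2Coord (Pi.single j.2 (1 : ℝ))‖ ≤ 9 := by nlinarith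
    have hCS0 : 0 ≤ CG ^ 2 * S := mul_nonneg (sq_nonneg _) hS0
    calc 331776 * ‖su2Coord (Pi.single i.2 (1 : ℝ))‖ * ‖su2Coord (Pi.single j.2 (1 : ℝ))‖ * CG ^ 2 * S
        = 331776 * ((‖su2Coord (Pi.single i.2 (1 : ℝ))‖ * ‖su2Coord (Pi.single j.2 (1 : ℝ))‖) * (CG ^ 2 * S)) := by ring
      _ ≤ 331776 * (9 * (CG ^ 2 * S)) := mul_le_mul_of_nonneg_left (mul_le_mul_of_nonneg_right this hCS0) (by norm_num)
      _ = 2985984 * CG ^ 2 * S := by ring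
  -- Cauchy–Schwarz over the endpoint pairs
  have hCS := sq_double_sum_le (fun z w : ↥(interiorSites H) => endInd i.1.1.1 (z : Site 4) * endInd j.1.1.1 (w : Site 4))
    (fun z w => 1 / (1 + siteDist (z : Site 4) (w : Site 4)) ^ 4) (fun z w => mul_nonneg (endInd_nonneg _ _) (endInd_nonneg _ _))
  have hSeq : S = ∑ z : ↥(interiorSites H), ∑ w : ↥(interiorSites H),
      1 / (1 + siteDist (z : Site 4) (w : Site 4)) ^ 4 * (endInd i.1.1.1 (z : Site 4) * endInd j.1.1.1 (w : Site 4)) := by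
    rw [hS]; exact Finset.sum_congr rfl fun z _ => Finset.sum_congr rfl fun w _ => by ring
  have hcount : ∑ z : ↥(interiorSites H), ∑ w : ↥(interiorSites H), endInd i.1.1.1 (z : Site 4) * endInd j.1.1.1 (w : Site 4) ≤ 4 := by
    rw [← Finset.sum_mul_sum]
    have a := sum_endInd_le (H := H) i.1.1.1
    have b := sum_endInd_le (H := H) j.1.1.1
    have a0 : 0 ≤ ∑ z : ↥(interiorSites H), endInd i.1.1.1 (z : Site 4) := Finset.sum_nonneg fun z _ => endInd_nonneg _ _
    nlinarith [Finset.sum_nonneg fun w (_ : w ∈ Finset.univ) => endInd_nonneg j.1.1.1 ((w : ↥(interiorSites H)) : Site 4)]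
  have hsq : (ghostX H (basisLinkL H i) * ghostX H (basisLinkL H j)).trace ^ 2 ≤ (K * S) ^ 2 := by
    rw [← sq_abs]; exact pow_le_pow_left₀ (abs_nonneg _) hT 2
  have h3 : 0 ≤ ∑ z : ↥(interiorSites H), ∑ w : ↥(interiorSites H),
      (1 / (1 + siteDist (z : Site 4) (w : Site 4)) ^ 4) ^ 2 * (endInd i.1.1.1 (z : Site 4) * endInd j.1.1.1 (w : Site 4)) :=
    Finset.sum_nonneg fun z _ => Finset.sum_nonneg fun w _ => mul_nonneg (sq_nonneg _) (mul_nonneg (endInd_nonneg _ _) (endInd_nonneg _ _))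
  calc _ ≤ (K * S) ^ 2 := hsq
    _ = K ^ 2 * S ^ 2 := by ring
    _ ≤ K ^ 2 * (4 * ∑ z : ↥(interiorSites H), ∑ w : ↥(interiorSites H),
          (1 / (1 + siteDist (z : Site 4) (w : Site 4)) ^ 4) ^ 2 * (endInd i.1.1.1 (z : Site 4) * endInd j.1.1.1 (w : Site 4))) := by
        refine mul_le_mul_of_nonneg_left ?_ (sq_nonneg _)
        rw [hSeq]
        refine hCS.trans ?_
        exact mul_le_mul_of_nonneg_right hcount h3
    _ = _ := by ring

/-- Exchange of summation for the row sums: `Σ_j Σ_z Σ_w u z w · (e z · c j w) = Σ_z e z · Σ_w u z w · Σ_j c j w`. -/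
theorem sum_exchange3 {α β : Type*} [Fintype α] [Fintype β] (u : α → α → ℝ) (e : α → ℝ) (c : β → α → ℝ) :
    ∑ j : β, ∑ z : α, ∑ w : α, u z w * (e z * c j w) = ∑ z : α, e z * ∑ w : α, u z w * ∑ j : β, c j w := by
  rw [Finset.sum_comm]
  refine Finset.sum_congr rfl fun z _ => ?_
  rw [Finset.sum_comm, Finset.mul_sum]
  refine Finset.sum_congr rfl fun w _ => ?_
  rw [Finset.mul_sum, Finset.mul_sum]
  exact Finset.sum_congr rfl fun j _ => by ring

/-- `(1+d)⁻⁸ ≤ (1+d)⁻⁶`. -/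
theorem inv_pow_eight_le_six (z w : Site 4) : (1 / (1 + siteDist z w) ^ 4) ^ 2 ≤ 1 / (1 + siteDist z w) ^ 6 := by
  have hd := GhostKernel.siteDist_nonneg z w
  have h1 : (1 : ℝ) ≤ 1 + siteDist z w := by linarith
  have h8 : (1 / (1 + siteDist z w) ^ 4) ^ 2 = 1 / (1 + siteDist z w) ^ 8 := by rw [div_pow, one_pow, ← pow_mul]
  rw [h8]
  exact one_div_le_one_div_of_le (by positivity) (pow_le_pow_right₀ h1 (by norm_num))

/-- **Row sums of the squared pairings**: `Σ_j (tr X_iX_j)² ≤ 393216 K²`. -/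
theorem sum_trace_sq_le (hG0 : ∀ x z : ↥(interiorSites H), 0 ≤ (dirichletMatrix (interiorSites H))⁻¹ x z) {CG : ℝ} (hCG : 0 ≤ CG)
    (hGd : ∀ x z : ↥(interiorSites H), (dirichletMatrix (interiorSites H))⁻¹ x z ≤ CG / (1 + siteDist (x : Site 4) (z : Site 4)) ^ 2)
    (i : LandauFree H × Fin 3) :
    ∑ j : LandauFree H × Fin 3, (ghostX H (basisLinkL H i) * ghostX H (basisLinkL H j)).trace ^ 2 ≤ 393216 * (2985984 * CG ^ 2) ^ 2 := by
  have hshell : ∀ z : ↥(interiorSites H), ∑ w : ↥(interiorSites H), (1 / (1 + siteDist (z : Site 4) (w : Site 4)) ^ 4) ^ 2 ≤ 2048 := by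
    intro z
    have h1 : ∑ w : ↥(interiorSites H), (1 / (1 + siteDist (z : Site 4) (w : Site 4)) ^ 4) ^ 2 ≤
        ∑ w : ↥(interiorSites H), 1 / (1 + siteDist (z : Site 4) (w : Site 4)) ^ 6 :=
      Finset.sum_le_sum fun w _ => inv_pow_eight_le_six (z : Site 4) (w : Site 4)
    have h2 := sum_interior_inv_pow_six_le (H := H) (z : Site 4)
    exact h1.trans h2
  calc ∑ j : LandauFree H × Fin 3, (ghostX H (basisLinkL H i) * ghostX H (basisLinkL H j)).trace ^ 2
      ≤ ∑ j : LandauFree H × Fin 3, 4 * (2985984 * CG ^ 2) ^ 2 * ∑ z : ↥(interiorSites H), ∑ w : ↥(interiorSites H),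
          (1 / (1 + siteDist (z : Site 4) (w : Site 4)) ^ 4) ^ 2 * (endInd i.1.1.1 (z : Site 4) * endInd j.1.1.1 (w : Site 4)) :=
        Finset.sum_le_sum fun j _ => trace_sq_le hG0 hCG hGd i j
    _ = 4 * (2985984 * CG ^ 2) ^ 2 * ∑ z : ↥(interiorSites H), endInd i.1.1.1 (z : Site 4) * ∑ w : ↥(interiorSites H),
          (1 / (1 + siteDist (z : Site 4) (w : Site 4)) ^ 4) ^ 2 * ∑ j : LandauFree H × Fin 3, endInd j.1.1.1 (w : Site 4) := by
        rw [← Finset.mul_sum, sum_exchange3]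
    _ = 4 * (2985984 * CG ^ 2) ^ 2 * ∑ z : ↥(interiorSites H), endInd i.1.1.1 (z : Site 4) * ∑ w : ↥(interiorSites H),
          (1 / (1 + siteDist (z : Site 4) (w : Site 4)) ^ 4) ^ 2 * 24 := by
        simp only [sum_endInd_coord]
    _ ≤ 4 * (2985984 * CG ^ 2) ^ 2 * ∑ z : ↥(interiorSites H), endInd i.1.1.1 (z : Site 4) * (2048 * 24) := by
        refine mul_le_mul_of_nonneg_left (Finset.sum_le_sum fun z _ => mul_le_mul_of_nonneg_left ?_ (endInd_nonneg _ _)) (by positivity)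
        rw [← Finset.sum_mul]
        exact mul_le_mul_of_nonneg_right (hshell z) (by norm_num)
    _ = 4 * (2985984 * CG ^ 2) ^ 2 * (2048 * 24) * ∑ z : ↥(interiorSites H), endInd i.1.1.1 (z : Site 4) := by
        rw [← Finset.sum_mul]; ring
    _ ≤ 4 * (2985984 * CG ^ 2) ^ 2 * (2048 * 24) * 2 := mul_le_mul_of_nonneg_left (sum_endInd_le _) (by positivity)
    _ = 393216 * (2985984 * CG ^ 2) ^ 2 := by ring

/-! ## The total -/

/-- ★ **`Σ_i Σ_j (M_H)_{ij}² ≤ ghostMConst C_G · H⁴`** for `H ≥ 1`. -/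
theorem sum_sq_ghostM_le (hH : 1 ≤ H) (hG0 : ∀ x z : ↥(interiorSites H), 0 ≤ (dirichletMatrix (interiorSites H))⁻¹ x z) {CG : ℝ}
    (hCG : 0 ≤ CG)
    (hGd : ∀ x z : ↥(interiorSites H), (dirichletMatrix (interiorSites H))⁻¹ x z ≤ CG / (1 + siteDist (x : Site 4) (z : Site 4)) ^ 2) :
    ∑ i : LandauFree H × Fin 3, ∑ j : LandauFree H × Fin 3, ghostM H i j ^ 2 ≤ ghostMConst CG * (H : ℝ) ^ 4 := by
  set K : ℝ := 2985984 * CG ^ 2 with hK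
  have hGC : ∀ x z : ↥(interiorSites H), (dirichletMatrix (interiorSites H))⁻¹ x z ≤ CG := by
    intro x z
    refine (hGd x z).trans (div_le_self hCG ?_)
    have hd := GhostKernel.siteDist_nonneg (x : Site 4) (z : Site 4)
    exact one_le_pow₀ (by linarith)
  have hD : ∀ e : LandauFree H, (ghostX H (basisLinkQ H e)).trace ^ 2 ≤ (288 * CG) ^ 2 := by
    intro e
    have h := abs_trace_ghostX_edgeMat_le hG0 hCG hGC e.1.1 (1 : Matrix (Fin 2) (Fin 2) ℂ)
    rw [norm_one, mul_one] at h
    rw [← sq_abs]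
    exact pow_le_pow_left₀ (abs_nonneg _) h 2
  -- per row
  have hrow : ∀ i : LandauFree H × Fin 3, ∑ j : LandauFree H × Fin 3, ghostM H i j ^ 2 ≤ 196608 * K ^ 2 + 41472 * CG ^ 2 := by
    intro i
    have hsplit : ∀ j : LandauFree H × Fin 3, ghostM H i j ^ 2 ≤
        1 / 2 * (ghostX H (basisLinkL H i) * ghostX H (basisLinkL H j)).trace ^ 2 +
          (if i = j then 1 / 2 * (ghostX H (basisLinkQ H i.1)).trace ^ 2 else 0) := by
      intro j
      rw [ghostM_apply]
      split_ifs
      · nlinarith [sq_nonneg ((ghostX H (basisLinkL H i) * ghostX H (basisLinkL H j)).trace - (ghostX H (basisLinkQ H i.1)).trace)]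
      · nlinarith [sq_nonneg (ghostX H (basisLinkL H i) * ghostX H (basisLinkL H j)).trace]
    calc ∑ j : LandauFree H × Fin 3, ghostM H i j ^ 2
        ≤ ∑ j : LandauFree H × Fin 3, (1 / 2 * (ghostX H (basisLinkL H i) * ghostX H (basisLinkL H j)).trace ^ 2 +
            (if i = j then 1 / 2 * (ghostX H (basisLinkQ H i.1)).trace ^ 2 else 0)) := Finset.sum_le_sum fun j _ => hsplit j
      _ = 1 / 2 * ∑ j : LandauFree H × Fin 3, (ghostX H (basisLinkL H i) * ghostX H (basisLinkL H j)).trace ^ 2 +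
            1 / 2 * (ghostX H (basisLinkQ H i.1)).trace ^ 2 := by
          rw [Finset.sum_add_distrib, Finset.sum_ite_eq, if_pos (Finset.mem_univ i), Finset.mul_sum]
      _ ≤ 1 / 2 * (393216 * K ^ 2) + 1 / 2 * (288 * CG) ^ 2 :=
          add_le_add (mul_le_mul_of_nonneg_left (sum_trace_sq_le hG0 hCG hGd i) (by norm_num))
            (mul_le_mul_of_nonneg_left (hD i.1) (by norm_num))
      _ = 196608 * K ^ 2 + 41472 * CG ^ 2 := by ring
  calc ∑ i : LandauFree H × Fin 3, ∑ j : LandauFree H × Fin 3, ghostM H i j ^ 2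
      ≤ ∑ _i : LandauFree H × Fin 3, (196608 * K ^ 2 + 41472 * CG ^ 2) := Finset.sum_le_sum fun i _ => hrow i
    _ = (Fintype.card (LandauFree H × Fin 3) : ℝ) * (196608 * K ^ 2 + 41472 * CG ^ 2) := by
        rw [Finset.sum_const, Finset.card_univ, nsmul_eq_mul]
    _ ≤ 972 * (H : ℝ) ^ 4 * (196608 * K ^ 2 + 41472 * CG ^ 2) := mul_le_mul_of_nonneg_right (card_coord_le hH) (by positivity)
    _ = ghostMConst CG * (H : ℝ) ^ 4 := by rw [ghostMConst, hK]; ring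

end GhostFP

end Summit.QuantumFields.YangMills.Theorems.AllWindowsColdBoxBoxHighLine

end
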